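import Summits.Schanuel.Schanuel.Statement
import Literature.NumberTheory.Transcendental.RoyCriterion
import Literature.Barriers.Schanuel.LargeTranscendenceDegree

/-!
# Schanuel's conjecture as a rank bound on exponential periods of subfields

Soloist file (`solo-Schanuel-informed`, 2026-08-18). New bookkeeping, no new transcendence input.

For a subfield `K ⊆ ℂ` put `E(K) = {x ∈ K : eˣ ∈ K}` (an additive subgroup of `K`). The normal form
recorded here is

  `Schanuel ⟺ ∀ K ≤ ℂ, every ℚ-linearly independent family in E(K) has size ≤ trdeg_ℚ K`,

rank by rank (`schanuelRank_iff_expRank_le_trdeg`): Schanuel's conjecture for rank `l` (Roy 2001,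
Conjecture 1, `Literature.NumberTheory.Transcendental.SchanuelRank l`) says exactly that no subfield
of transcendence degree `< l` carries `l` independent exponential periods. In particular
(`schanuelRank_two_iff_expRank_le_one`) the first open rung `l = 2` (which contains the algebraic
independence of `e` and `π`, of `e` and `eᵉ`, of `log 2` and `log 3`) is the statement that a field of
transcendence degree `≤ 1` never contains two `ℚ`-independent numbers together with their
exponentials (the uniform weakening — some bound `N` on that rank for all fields of transcendence
degree `≤ 1` — is stated as an open conjecture in `SoloInformedUniformExpRankBound.lean`).

References: S. Lang, *Introduction to transcendental numbers* (1966) pp. 30–31 (Schanuel's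
conjecture); D. Roy, *An arithmetic criterion for the values of the exponential function*, Acta Arith.
97 (2001), Conjecture 1 (rank-`l` form); J. Kirby, *Exponential algebraicity in exponential fields*,
Bull. LMS 42 (2010) §1 (predimension `δ(x̄) = td(x̄, eˣ̄) − ldim_ℚ x̄`); M. Waldschmidt, *Diophantine
approximation on linear algebraic groups* (2000), Conjecture 1.14 and §1.4.
-/

noncomputable section

open Complex IntermediateField

namespace Summit.Schanuel.Schanuel.Theorems

/-- `ℚ(x, eˣ) ≤ K` when the `xᵢ` and the `e^{xᵢ}` lie in `K`. -/
theorem adjoin_exp_le {l : ℕ} {K : IntermediateField ℚ ℂ} {x : Fin l → ℂ}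
    (hx : ∀ i, x i ∈ K) (hex : ∀ i, cexp (x i) ∈ K) :
    adjoin ℚ (Set.range x ∪ Set.range (cexp ∘ x)) ≤ K := by
  rw [adjoin_le_iff]
  rintro _ (⟨i, rfl⟩ | ⟨i, rfl⟩)
  · exact hx i
  · exact hex i

/-- **Normal form, rank by rank.** Schanuel's conjecture for rank `l` is equivalent to the
exponential-period rank bound at rank `l`: for every subfield `K ⊆ ℂ` and every `ℚ`-linearly
independent `x : Fin l → ℂ` with all `xᵢ ∈ K` and all `e^{xᵢ} ∈ K`, `l ≤ trdeg_ℚ K`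
(informally `rank E(K) ≤ trdeg_ℚ K` tested on `l`-tuples, `E(K) = {x ∈ K : eˣ ∈ K}`).
(`→`) `ℚ(x, eˣ) ≤ K` and monotonicity of `trdeg` (`Literature.Barriers.Schanuel.trdeg_mono`);
(`←`) take `K = ℚ(x, eˣ)`. -/
theorem schanuelRank_iff_expRank_le_trdeg (l : ℕ) :
    Literature.NumberTheory.Transcendental.SchanuelRank l ↔
      ∀ (K : IntermediateField ℚ ℂ) (x : Fin l → ℂ), (∀ i, x i ∈ K) → (∀ i, cexp (x i) ∈ K) →
        LinearIndependent ℚ x → (l : Cardinal) ≤ Algebra.trdeg ℚ ↥K := by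
  constructor
  · intro h K x hx hex hli
    exact (h x hli).trans (Literature.Barriers.Schanuel.trdeg_mono (adjoin_exp_le hx hex))
  · intro h x hli
    refine h _ x (fun i => ?_) (fun i => ?_) hli
    · exact subset_adjoin ℚ _ (Or.inl ⟨i, rfl⟩)
    · exact subset_adjoin ℚ _ (Or.inr ⟨i, rfl⟩)

/-- **Normal form of the summit.** Schanuel's conjecture is the statement that for every subfield
`K ⊆ ℂ` the `ℚ`-linearly independent families of exponential periods of `K` (numbers `x ∈ K` with
`eˣ ∈ K`) have size at most `trdeg_ℚ K`. -/
theorem schanuel_iff_forall_expRank_le_trdeg :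
    _root_.Schanuel ↔
      ∀ (l : ℕ) (K : IntermediateField ℚ ℂ) (x : Fin l → ℂ), (∀ i, x i ∈ K) →
        (∀ i, cexp (x i) ∈ K) → LinearIndependent ℚ x → (l : Cardinal) ≤ Algebra.trdeg ℚ ↥K := by
  unfold _root_.Schanuel Literature.Periods.SchanuelConjecture
  exact forall_congr' fun l => schanuelRank_iff_expRank_le_trdeg l

/-- From the rank bound at rank `2`: a field of transcendence degree `≤ 1` contains at most one
`ℚ`-independent exponential period (restrict an independent family to its first two members). -/
theorem expRank_le_one_of_schanuelRank_two
    (h2 : Literature.NumberTheory.Transcendental.SchanuelRank 2) (K : IntermediateField ℚ ℂ)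
    (hK : Algebra.trdeg ℚ ↥K ≤ 1) (n : ℕ) (x : Fin n → ℂ) (hx : ∀ i, x i ∈ K)
    (hex : ∀ i, cexp (x i) ∈ K) (hli : LinearIndependent ℚ x) : n ≤ 1 := by
  rw [schanuelRank_iff_expRank_le_trdeg] at h2
  by_contra hn
  have hn2 : 2 ≤ n := by omega
  have hli2 : LinearIndependent ℚ (x ∘ Fin.castLE hn2) := hli.comp _ (Fin.castLE_injective hn2)
  have h := h2 K (x ∘ Fin.castLE hn2) (fun i => hx _) (fun i => hex _) hli2
  have h21 : ((2 : ℕ) : Cardinal.{0}) ≤ ((1 : ℕ) : Cardinal.{0}) := by simpa using h.trans hK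
  have : (2 : ℕ) ≤ 1 := by exact_mod_cast h21
  omega

/-- **Rank two.** Schanuel's conjecture for rank `2` is equivalent to: no subfield of `ℂ` of
transcendence degree `≤ 1` contains two `ℚ`-linearly independent numbers together with their
exponentials (every such field has exponential-period rank `≤ 1`). -/
theorem schanuelRank_two_iff_expRank_le_one :
    Literature.NumberTheory.Transcendental.SchanuelRank 2 ↔
      ∀ (K : IntermediateField ℚ ℂ), Algebra.trdeg ℚ ↥K ≤ 1 →
        ∀ (n : ℕ) (x : Fin n → ℂ), (∀ i, x i ∈ K) → (∀ i, cexp (x i) ∈ K) →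
          LinearIndependent ℚ x → n ≤ 1 := by
  refine ⟨expRank_le_one_of_schanuelRank_two, fun h => ?_⟩
  rw [schanuelRank_iff_expRank_le_trdeg]
  intro K x hx hex hli
  by_contra hlt
  have hK : Algebra.trdeg ℚ ↥K ≤ 1 := by
    have hlt' : Algebra.trdeg ℚ ↥K < ((2 : ℕ) : Cardinal.{0}) := not_le.mp hlt
    have h2 : Order.succ ((1 : ℕ) : Cardinal.{0}) = ((2 : ℕ) : Cardinal.{0}) := by
      rw [Cardinal.succ_natCast]; norm_cast
    rw [← h2, Order.lt_succ_iff] at hlt'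
    simpa using hlt'
  have := h K hK 2 x hx hex hli
  omega

end Summit.Schanuel.Schanuel.Theorems
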